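import Literature.AlgebraicGeometry.HodgeTheory.ComplexOrientationFamily
import Literature.AlgebraicTopology.SingularHomology.GysinTransposition
import Literature.AlgebraicGeometry.HodgeTheory.CycleClassVanishingOfHodgePairing
import HarnessLib

/-!
# Route AmpleAdicLefschetz — crux `ThickDescent` (stmt-HodgeConjecture-2613), stub
# `stub_gysinZero_cup`: the Gysin morphism is the Poincaré transpose of the pull-back

For a morphism `f : Y ⟶ X` of smooth projective complex varieties (`dim X = n`, `dim Y = m`),
degrees `a + 2n = b + 2m`, `a + k = 2m`, and a class `x' ∈ Hᵃ(Y(ℂ); ℂ)` killed by the Gysin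
morphism `f_* : Hᵃ(Y(ℂ); ℂ) → Hᵇ(X(ℂ); ℂ)` of the complex orientation family
(`complexGysin complexOrientationFamily`), the cup product `x' ∪ f^* y ∈ H^{2m}(Y(ℂ); ℂ)` vanishes
for every `y ∈ Hᵏ(X(ℂ); ℂ)`. This is W. Fulton, *Young Tableaux* (1997), App. B §B.1 (5)–(6):
`f_*` is `D_X⁻¹ ∘ f(ℂ)_* ∘ D_Y`, so `∫_X f_* x' ∪ y = ∫_Y x' ∪ f^* y`, and `z ↦ ∫_Y z` is one-to-one
on the top degree `H^{2m}(Y(ℂ); ℂ)`.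

On the tree, all three steps are PROVED:

* `complexGysin_eq_gysinMap` — in degrees `a ≤ 2m` (forced by `a + k = 2m`) the Gysin morphism is
  the topological `gysinMap` through `H_k`;
* `cupPairing_gysinMap` — `⟨f_* x' ∪ y, [X(ℂ)]⟩ = ⟨x' ∪ f^* y, [Y(ℂ)]⟩`, granted Poincaré duality of
  the target orientation (`hasPoincareDuality_complexOrientationFamily`);
* `eq_zero_of_kroneckerPairing_fundamentalClass_eq_zero` — a top-degree class pairing to zero with
  the fundamental class `[Y(ℂ)]` of the complex orientation family vanishes.

No named fact is introduced.

## References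

* [FultonYoungTableaux1997] W. Fulton, Young Tableaux, CUP 1997, App. B §B.1 (5)–(6).
* [HatcherAT2002] A. Hatcher, Algebraic Topology, CUP 2002, Prop. 2.7, §3.3 Thm. 3.30.
-/

noncomputable section

-- every declaration of this problem lives in `Summit.HodgeConjecture.HodgeConjecture.…` (summit = sub-problem)
set_option linter.dupNamespace false

namespace Summit.HodgeConjecture.HodgeConjecture.Theorems

open CategoryTheory AlgebraicGeometry
open Literature.AlgebraicGeometry Literature.AlgebraicGeometry.Motives Literature.AlgebraicGeometry.HodgeTheory
open Literature.AlgebraicTopology.SingularHomology Literature.Geometry.Kaehler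

/-! ### The transposition identity for the Gysin morphism of the complex orientation family -/

/-- **`⟨f_* x' ∪ y, [X(ℂ)]⟩ = ⟨x' ∪ f^* y, [Y(ℂ)]⟩`** for the Gysin morphism of the complex
orientation family, in degrees `a + k = 2 dim Y`, `b + k = 2 dim X` (Fulton App. B (5)–(6): the
projection formula and `⟨f_* z, [X]⟩ = ⟨z, [Y]⟩`; the tree's `cupPairing_gysinMap` after
`complexGysin_eq_gysinMap`). [cite: FultonYoungTableaux1997, Appendix B §B.1 (5)–(6)] -/
theorem cupPairing_complexGysin_complexOrientationFamily {n m a b k : ℕ} {X Y : SchemeOver ℂ}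
    (f : Y ⟶ X) (hX : IsSmoothProjective n X) (hY : IsSmoothProjective m Y)
    (hab : a + 2 * n = b + 2 * m) (hk : a + k = 2 * m) (hbk : b + k = 2 * n)
    (x' : complexBetti Y a) (y : complexBetti X k) :
    cupPairing (complexOrientationFamily hX) hbk (complexGysin complexOrientationFamily hY hX f hab x') y =
      cupPairing (complexOrientationFamily hY) hk x' (complexBetti.map f k y) := by
  rw [complexGysin_eq_gysinMap hY hX f hab hk hbk]
  exact cupPairing_gysinMap (hasPoincareDuality_complexOrientationFamily hX)
    (AlgPoints.mapContinuous (L := ℂ) f) hk hbk x' y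

/-! ### The stub -/

/-- **Stub `stub_gysinZero_cup` of the crux `ThickDescent`** — THE GYSIN MORPHISM IS THE POINCARÉ
TRANSPOSE OF `f^*`: for a morphism `f : Y ⟶ X` of smooth projective varieties (`dim X = n`,
`dim Y = m`), degrees `a + 2n = b + 2m`, `a + k = 2m`, and `x' ∈ Hᵃ(Y(ℂ); ℂ)` with `f_* x' = 0`
(`f_*` the Gysin morphism of `complexOrientationFamily`): `x' ∪ f^* y = 0` in `H^{2m}(Y(ℂ); ℂ)` for
every `y ∈ Hᵏ(X(ℂ); ℂ)`. Proof: `⟨x' ∪ f^* y, [Y(ℂ)]⟩ = ⟨f_* x' ∪ y, [X(ℂ)]⟩ = 0`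
(`cupPairing_complexGysin_complexOrientationFamily`), and a top-degree class pairing to zero with
`[Y(ℂ)]` vanishes (`eq_zero_of_kroneckerPairing_fundamentalClass_eq_zero`).
[cite: FultonYoungTableaux1997, Appendix B §B.1 (5)–(6)] [cite: HatcherAT2002, §3.3 Thm. 3.30] -/
theorem stub_gysinZero_cup :
    ∀ ⦃n m a b k : ℕ⦄ ⦃X Y : SchemeOver ℂ⦄ (f : Y ⟶ X) (hX : IsSmoothProjective n X)
      (hY : IsSmoothProjective m Y) (hab : a + 2 * n = b + 2 * m) (hk : a + k = 2 * m)
      (x' : complexBetti Y a),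
      complexGysin complexOrientationFamily hY hX f hab x' = 0 →
      ∀ y : complexBetti X k, cupProduct hk x' (complexBetti.map f k y) = 0 := by
  intro n m a b k X Y f hX hY hab hk x' hx' y
  have hbk : b + k = 2 * n := by omega
  -- `⟨x' ∪ f^* y, [Y(ℂ)]⟩ = ⟨f_* x' ∪ y, [X(ℂ)]⟩ = ⟨0 ∪ y, [X(ℂ)]⟩ = 0`
  have hpair : cupPairing (complexOrientationFamily hY) hk x' (complexBetti.map f k y) = 0 := by
    rw [← cupPairing_complexGysin_complexOrientationFamily f hX hY hab hk hbk x' y, hx', map_zero,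
      LinearMap.zero_apply]
  rw [cupPairing_apply] at hpair
  exact eq_zero_of_kroneckerPairing_fundamentalClass_eq_zero hY hpair

end Summit.HodgeConjecture.HodgeConjecture.Theorems

end
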